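import Summits.BirchSwinnertonDyer.Rank1Residual.Additive.TypeGThree
import Summits.BirchSwinnertonDyer.Rank1Residual.Additive.GordDescentFreeFieldDatum
import HarnessLib

/-!
# X3♯(G-ord) / X4♯(G-ord) at `p = 3`: the class theorems from the sub-class predicate ALONE
# (the twist-good datum discharged by `TypeGThree.lean`)

HONEST FRAMING (cell `b2b-bsdres`, run/shared/lean/b2b/bsd-rank1-residual/, verbatim in every
file): the goal of the cell is to DELETE the COMBINATION-SHAPED residual classes of the
Birch–Swinnerton-Dyer formula for ALL analytic-rank `≤ 1` elliptic curves over `ℚ` — "full BSD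
formula for every rank `≤ 1` curve in class `C`" assembled STRICTLY from published theorems — so
that the rank-`≤ 1` remainder becomes exactly the CONSTRUCTION-SHAPED classes, which are TYPED
(missing-input `Prop`s), NOT attempted. This is not "finishing BSD". Sub-cell `additive-p2`
(CLASS-OWNERS row "X3/X4 additive — pot. good ordinary / X3♯(G-ord)"), generation 7: research
route; no claim beyond the stated classes; theorems only, no definition, no new named fact;
X3♯(G-ord)/X4♯(G-ord) stay CONSTRUCTION-SHAPED; labels / census / located gap UNCHANGED.

WHAT THIS FILE DOES. Gens 4 and 6 proved the `p = 3` class theorems of the sub-cell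
(`bsdp_three_of_classX3_cases`, `bsdp_iff_overC_three_of_classX4Gord_of_surj`,
`bsdp_three_of_classX4Gord_of_surj` in `GordDescentModelFreeThree.lean`;
`bsdp_three_of_classX3_of_forall_ramified`, `bsdp_three_of_classX4Gord_of_surj_of_forall_ramified`
in `GordDescentFreeFieldThree.lean`) under the model-free DATUM
`hgood : every globally minimal model of E^{(−3)} has good reduction at 3` — the one place where
the kernel dictionary "census data ⟺ theory class" was incomplete (census: the datum holds on all
421 sub-class pairs at `p = 3`). Generation 7's `TypeGThree.lean` PROVES the datum from Delbourgo's
(G) (`hasGoodReductionAtPrime_twist_three_of_typeG_of_addv`, Tate's algorithm for tame `I₀*` at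
`p = 3`, no Néron–Ogg–Shafarevich input). This file substitutes it:

* `classX3Gord_three_of_typeG` — `ClassX3 W 3 → TypeG W 3 → ClassX3Gord W 3` (for X3 the
  ordinarity bit is automatic at `p = 3` too: Serre Prop. 12 via gen 3's `goodOrd_twist_of_red`);
  `classX3Gord_three_iff_typeG`.
* **`bsdp_three_of_classX3Gord_of_forall_ramified`** — X3♯(G-ord) at `p = 3`, `r_an(E) ≤ 1`:
  `BSD(E,3)` from the over-`K` input `MissingPPartOverCAt (W.baseChange K) 3` over the quadratic
  fields `K` with `3 ∣ d_K`, and NOTHING ELSE (published binders as in gen 6: Castella–Grossi–Skinner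
  Thm. D chain for the row-C6 twist, Greenberg–Vatsal, Greenberg, modularity, GZK, Milne,
  Hoffstein–Luo supply).
* **`bsdp_three_of_classX4Gord_of_surj_of_forall_ramified'`** — X4♯(G-ord) at `p = 3`, `ρ̄_{E,3}`
  onto, `r_an(E) ≤ 1`: `BSD(E,3)` from the over-`K` input alone (row C16: Yan–Zhu Thm. 4.15 /
  Wuthrich Lemma 20; Milne; GZK; modularity; Hoffstein–Luo).
* `bsdp_iff_overC_three_of_classX4Gord_of_surj'` — the EXACT relocation at `p = 3` (`BSDp W 3 ↔
  MissingPPartOverCAt (W.baseChange K) 3`, `d_K = −3`, `r_an(E^{(−3)}) ≤ 1`) without `hgood`;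
  `bsdp_three_of_classX3Gord_cases` — gen 4's complete case split for X3 without `hgood`.
* **`ClassX4Gord.exists_quadraticField_goodOrd_bsdp_iff_three`**,
  **`ClassX3Gord.exists_quadraticField_goodOrd_bsdp_iff_three`** — the `p = 3` twins of gen 6's
  one-sentence forms (`GordDescentFreeFieldDatum.lean`, `p ≥ 5`): a quadratic `K`, `3 ∣ d_K`, with
  `E_K` GOOD ORDINARY at every `w ∋ 3` (`e(w|3) = 2`) and `BSDp W 3 ↔ MissingPPartOverCAt (E_K) 3`.

NET: the defect-2 residue of X3♯(G-ord)/X4♯(G-ord) is ONE typed statement — "the `p`-part of BSD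
for `E` over the quadratic fields ramified at `p`" — uniformly at EVERY prime `p ≥ 3`, from the
sub-class predicate (`ClassX3Gord` / `ClassX4Gord ∧ Surj`) and `r_an(E) ≤ 1` alone; at `p = 3` the
whole sub-class is defect 2 (`semistabilityIndex_eq_two_of_typeG_three`). Labels UNCHANGED: the
over-`K` input at a prime RAMIFIED in `K` is reached by no published theorem (AUDIT-X34-GORD.md §3).

References: J. Tate, Antwerp IV, LNM 476 (1975) §7; D. Delbourgo, Compositio Math. 113 (1998)
§1.5; J.-P. Serre, Invent. Math. 15 (1972) §1.11 Prop. 12; F. Castella, G. Grossi, C. Skinner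
(2025) Thm. D; X. Yan, X. Zhu (2026) Thm. 4.15; C. Wuthrich, Doc. Math. 19 (2014) 381–402, Lemma 20;
J. S. Milne, Invent. Math. 17 (1972); J. Hoffstein, W. Luo, Math. Res. Lett. 4 (1997).
-/

noncomputable section

open scoped Classical NumberField

open WeierstrassCurve IsDedekindDomain NumberField Literature.NumberTheory.EllipticCurves
  Literature.NumberTheory.EllipticCurves.Rank1Residual
  Literature.NumberTheory.EllipticCurves.Rank1Residual.Typed
  Literature.NumberTheory.EllipticCurves.ModularForms
  Literature.NumberTheory.EllipticCurves.Wuthrich2014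
  Summit.BirchSwinnertonDyer.Rank1Residual.AdditivePotMult

namespace Summit.BirchSwinnertonDyer.Rank1Residual.Additive

variable (W : WeierstrassCurve ℚ) [W.IsElliptic] [W.IsGloballyMinimal]

/-! ### X3 at `p = 3`: (G) alone is the sub-class -/

/-- **X3 ∩ (G) at `p = 3` ⊆ X3♯(G-ord)**: an Eisenstein additive pair at `3` of Delbourgo type (G)
is (G)-ORDINARY — the twist `E^{(−3)}` is good at `3` (`TypeGThree.lean`) and then good ordinary
(`goodOrd_twist_of_red`, Serre Prop. 12), so gen 0's `classX3Gord_of_goodOrd_quadraticTwist`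
applies. The `p = 3` twin of gen 3's `classX3Gord_of_subGord`. [cite: Serre1972, §1.11 Prop. 12] -/
theorem classX3Gord_three_of_typeG (hX : ClassX3 W 3) (hG : TypeG W 3) : ClassX3Gord W 3 :=
  classX3Gord_three_of_good_twist W hX
    (fun Wd _ _ hWd ↦ hasGoodReductionAtPrime_twist_three_of_typeG_of_addv W hG hX.2 Wd hWd)

/-- At `p = 3`, for an X3 pair: `ClassX3Gord W 3 ↔ TypeG W 3`. -/
theorem classX3Gord_three_iff_typeG (hX : ClassX3 W 3) : ClassX3Gord W 3 ↔ TypeG W 3 :=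
  ⟨fun h ↦ h.typeGOrd.typeG, classX3Gord_three_of_typeG W hX⟩

/-! ### The `p = 3` class theorems, datum-free -/

/-- **X3♯(G-ord) at `p = 3`, `r_an(E) ≤ 1`: `BSD(E,3)` from the over-`K` input over the quadratic
fields RAMIFIED at `3` — and nothing else.** Gen 6's `bsdp_three_of_classX3_of_forall_ramified` with
its twist-good datum `hgood` DISCHARGED by `hasGoodReductionAtPrime_twist_three_of_typeG_of_addv`
(Tate's algorithm at `3`). Binders (published, displayed): Castella–Grossi–Skinner 2025 Thm. D chain
(`hCGS`, with `hGV`, `hGr`, `hmodP`) for the row-C6 twist `E^{(−3d')}`, modularity `hmod`, GZK,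
Milne any-model `hMilneC`, Hoffstein–Luo supply `hHL`. The over-`K` input
`MissingPPartOverCAt (W.baseChange K) 3` is asked over every quadratic `K` with `3 ∣ d_K`.
[cite: HoffsteinLuo1997, Theorem (§1, pp. 435–436)] [cite: CastellaGrossiSkinner2025, Thm. D (= 'Thm. 4')] -/
theorem bsdp_three_of_classX3Gord_of_forall_ramified
    (hCGS : CastellaGrossiSkinner2025.thmD_padicValRat_bsd_rank_le_one)
    (hGV : GreenbergVatsal2000.thm13_charIdeal_eq_of_gvPar) (hGr : greenberg_charValue_rankZero)
    (hmod : hasEntireLFunction_rat) (hmodP : nonempty_modularParametrizationData)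
    (hGZK : rank_eq_analyticRank_of_analyticRank_le_one)
    (hMilneC : Milne1972.bsdQuotient_baseChange_quadratic_anyModel)
    (hHL : HoffsteinLuo1997_exists_twist_L_one_ne_zero)
    (hX : ClassX3Gord W 3) (hr : W.analyticRank ≤ 1)
    (hK : ∀ (K : Type) [Field K] [NumberField K], Module.finrank ℚ K = 2 →
      (3 : ℤ) ∣ NumberField.discr K → MissingPPartOverCAt (W.baseChange K) 3) :
    BSDp W 3 :=
  bsdp_three_of_classX3_of_forall_ramified W hCGS hGV hGr hmod hmodP hGZK hMilneC hHL hX.classX3 hr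
    (fun Wd _ _ hWd ↦
      hasGoodReductionAtPrime_twist_three_of_typeG_of_addv W hX.typeGOrd.typeG hX.addv Wd hWd) hK

/-- The same from `ClassX3 W 3 ∧ TypeG W 3` (plain (G); ordinarity is automatic for X3). -/
theorem bsdp_three_of_classX3_of_typeG_of_forall_ramified
    (hCGS : CastellaGrossiSkinner2025.thmD_padicValRat_bsd_rank_le_one)
    (hGV : GreenbergVatsal2000.thm13_charIdeal_eq_of_gvPar) (hGr : greenberg_charValue_rankZero)
    (hmod : hasEntireLFunction_rat) (hmodP : nonempty_modularParametrizationData)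
    (hGZK : rank_eq_analyticRank_of_analyticRank_le_one)
    (hMilneC : Milne1972.bsdQuotient_baseChange_quadratic_anyModel)
    (hHL : HoffsteinLuo1997_exists_twist_L_one_ne_zero)
    (hX : ClassX3 W 3) (hG : TypeG W 3) (hr : W.analyticRank ≤ 1)
    (hK : ∀ (K : Type) [Field K] [NumberField K], Module.finrank ℚ K = 2 →
      (3 : ℤ) ∣ NumberField.discr K → MissingPPartOverCAt (W.baseChange K) 3) :
    BSDp W 3 :=
  bsdp_three_of_classX3Gord_of_forall_ramified W hCGS hGV hGr hmod hmodP hGZK hMilneC hHL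
    (classX3Gord_three_of_typeG W hX hG) hr hK

/-- **X4♯(G-ord) at `p = 3`, `ρ̄_{E,3}` onto, `r_an(E) ≤ 1`: `BSD(E,3)` from the over-`K` input over
the quadratic fields RAMIFIED at `3` — and nothing else.** Gen 6's
`bsdp_three_of_classX4Gord_of_surj_of_forall_ramified` with `hgood` DISCHARGED. Binders: row C16
(Yan–Zhu 2026 Thm. 4.15 `hYZ`, Wuthrich Lemma 20 `hW20`), modularity, GZK, Milne, Hoffstein–Luo.
[cite: HoffsteinLuo1997, Theorem (§1, pp. 435–436)]
[cite: YanZhu2024MainConjNonCM, Thm. 4.15 (§4.6)] -/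
theorem bsdp_three_of_classX4Gord_of_surj_of_forall_ramified'
    (hYZ : YanZhu2026.thm415_padicValRat_bsd_rank_le_one)
    (hW20 : Wuthrich2014.lemma20_surjective_threeAdic_of_semistable)
    (hmod : hasEntireLFunction_rat) (hGZK : rank_eq_analyticRank_of_analyticRank_le_one)
    (hMilneC : Milne1972.bsdQuotient_baseChange_quadratic_anyModel)
    (hHL : HoffsteinLuo1997_exists_twist_L_one_ne_zero)
    (hX : ClassX4Gord W 3) (hsurj : Surj W 3) (hr : W.analyticRank ≤ 1)
    (hK : ∀ (K : Type) [Field K] [NumberField K], Module.finrank ℚ K = 2 →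
      (3 : ℤ) ∣ NumberField.discr K → MissingPPartOverCAt (W.baseChange K) 3) :
    BSDp W 3 :=
  bsdp_three_of_classX4Gord_of_surj_of_forall_ramified W hYZ hW20 hmod hGZK hMilneC hHL hX hsurj hr
    (fun Wd _ _ hWd ↦
      hasGoodReductionAtPrime_twist_three_of_typeG_of_addv W hX.typeGOrd.typeG hX.addv.2 Wd hWd) hK

/-- **Exact relocation at `p = 3` without the twist-good datum** (X4♯(G-ord), surj(3),
`r_an(E) ≤ 1`, `r_an(E^{(−3)}) ≤ 1`, any quadratic `K` with `d_K = −3`):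
`BSDp W 3 ↔ MissingPPartOverCAt (W.baseChange K) 3` — gen 4's
`bsdp_iff_overC_three_of_classX4Gord_of_surj` with `hgood` discharged.
[cite: YanZhu2024MainConjNonCM, Thm. 4.15 (§4.6)] -/
theorem bsdp_iff_overC_three_of_classX4Gord_of_surj'
    (hYZ : YanZhu2026.thm415_padicValRat_bsd_rank_le_one)
    (hW20 : Wuthrich2014.lemma20_surjective_threeAdic_of_semistable)
    (hGZK : rank_eq_analyticRank_of_analyticRank_le_one) (hmod : hasEntireLFunction_rat)
    (hMilneC : Milne1972.bsdQuotient_baseChange_quadratic_anyModel)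
    (hX : ClassX4Gord W 3) (hsurj : Surj W 3) (hr : W.analyticRank ≤ 1)
    (hrd : (W.quadraticTwist ((-1 : ℚ) ^ ((3 : ℕ) / 2) * (3 : ℕ))).analyticRank ≤ 1)
    (K : Type) [Field K] [NumberField K] (h2 : Module.finrank ℚ K = 2)
    (hdK : (NumberField.discr K : ℚ) = (-1 : ℚ) ^ ((3 : ℕ) / 2) * (3 : ℕ)) :
    BSDp W 3 ↔ MissingPPartOverCAt (W.baseChange K) 3 :=
  bsdp_iff_overC_three_of_classX4Gord_of_surj W hYZ hW20 hGZK hmod hMilneC hX hsurj hr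
    (fun Wd _ _ hWd ↦
      hasGoodReductionAtPrime_twist_three_of_typeG_of_addv W hX.typeGOrd.typeG hX.addv.2 Wd hWd)
    hrd K h2 hdK

/-- **X3♯(G-ord) at `p = 3` — gen 4's complete case split without the twist-good datum**
(over-`K` input for `d_K = −3` plus the typed X1 input of the twist pair when that pair is X1;
binders as in `bsdp_three_of_classX3_cases`). Superseded for `r_an(E) ≤ 1` by
`bsdp_three_of_classX3Gord_of_forall_ramified` (no X1 input), kept for the record.
[cite: Wuthrich2014, Prop. 21 (p. 400)] -/
theorem bsdp_three_of_classX3Gord_cases (hSk : Skinner2016.thmC_padicValRat_bsd_rank_zero)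
    (hBCS : BurungaleCastellaSkinner2025.cor131_padicValRat_bsd_rank_le_one)
    (hJSW : JetchevSkinnerWan2017.thm121_padicValRat_bsd_rank_one)
    (hCGS : CastellaGrossiSkinner2025.thmD_padicValRat_bsd_rank_le_one)
    (hGV : GreenbergVatsal2000.thm13_charIdeal_eq_of_gvPar) (hGr : greenberg_charValue_rankZero)
    (hmod : hasEntireLFunction_rat) (hmodP : nonempty_modularParametrizationData)
    (hGZK : rank_eq_analyticRank_of_analyticRank_le_one)
    (hCM : bsdTriple_of_hasCM_of_L_one_ne_zero) (hKob : Kobayashi2013.cor14_bsdp_of_cm_rank_one)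
    (hYZ : YanZhu2026.thm415_padicValRat_bsd_rank_le_one)
    (hW20 : Wuthrich2014.lemma20_surjective_threeAdic_of_semistable)
    (hLLT : LiLiuTian2024.thm11_bsdp_of_cm_rank_one) (hW' : sha_dvd_analyticSha)
    (hMilneC : Milne1972.bsdQuotient_baseChange_quadratic_anyModel)
    (hX : ClassX3Gord W 3) (hr : W.analyticRank ≤ 1)
    (hrd : (W.quadraticTwist ((-1 : ℚ) ^ ((3 : ℕ) / 2) * (3 : ℕ))).analyticRank ≤ 1)
    (hK : ∀ (K : Type) [Field K] [NumberField K], Module.finrank ℚ K = 2 →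
      (NumberField.discr K : ℚ) = (-1 : ℚ) ^ ((3 : ℕ) / 2) * (3 : ℕ) →
        MissingPPartOverCAt (W.baseChange K) 3)
    (hX1 : ∀ (Wd : WeierstrassCurve ℚ) [Wd.IsElliptic] [Wd.IsGloballyMinimal],
      (∃ C : VariableChange ℚ, C • W.quadraticTwist ((-1 : ℚ) ^ ((3 : ℕ) / 2) * (3 : ℕ)) = Wd) →
      ClassX1 Wd 3 → X1.MissingInputAt Wd 3) :
    BSDp W 3 :=
  bsdp_three_of_classX3_cases W hSk hBCS hJSW hCGS hGV hGr hmod hmodP hGZK hCM hKob hYZ hW20 hLLT hW'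
    hMilneC hX.classX3 hr
    (fun Wd _ _ hWd ↦
      hasGoodReductionAtPrime_twist_three_of_typeG_of_addv W hX.typeGOrd.typeG hX.addv Wd hWd)
    hrd hK hX1

/-! ### One sentence at `p = 3` (the `p = 3` twins of gen 6's `…exists_quadraticField_goodOrd_bsdp_iff`) -/

/-- **X4♯(G-ord) at `p = 3`, `ρ̄_{E,3}` onto, `r_an(E) ≤ 1 — the one-sentence form.** There is a
quadratic field `K` with `3 ∣ d_K` over which `E` has GOOD ORDINARY reduction at every prime `w ∋ 3`
(`e(w|3) = 2`) and for which `BSDp W 3 ↔ MissingPPartOverCAt (W.baseChange K) 3`. The field is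
`ℚ(√(−3d'))` for the Hoffstein–Luo twist `E^{(−3d')}` (good ordinary, rank 0, row C16), supplied from
the twist `E^{(−3)}` — good ORDINARY at `3` by `goodOrd_twist_three_of_typeGOrd` (gen 7, Tate's
algorithm) instead of a datum. [cite: HoffsteinLuo1997, Theorem (§1, pp. 435–436)]
[cite: YanZhu2024MainConjNonCM, Thm. 4.15 (§4.6)] -/
theorem ClassX4Gord.exists_quadraticField_goodOrd_bsdp_iff_three
    (hYZ : YanZhu2026.thm415_padicValRat_bsd_rank_le_one)
    (hW20 : Wuthrich2014.lemma20_surjective_threeAdic_of_semistable)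
    (hmod : hasEntireLFunction_rat) (hGZK : rank_eq_analyticRank_of_analyticRank_le_one)
    (hMilneC : Milne1972.bsdQuotient_baseChange_quadratic_anyModel)
    (hHL : HoffsteinLuo1997_exists_twist_L_one_ne_zero)
    (hX : ClassX4Gord W 3) (hsurj : Surj W 3) (hr : W.analyticRank ≤ 1) :
    ∃ (K : Type) (_ : Field K) (_ : NumberField K), Module.finrank ℚ K = 2 ∧
      (3 : ℤ) ∣ NumberField.discr K ∧
      (∀ w : HeightOneSpectrum (𝓞 K), ((3 : ℕ) : 𝓞 K) ∈ w.asIdeal →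
        (W.baseChange K).HasGoodReductionAt w ∧ (W.baseChange K).HasUnitRootAt w ∧
          (Ideal.span {((3 : ℕ) : ℤ)}).ramificationIdx' w.asIdeal = 2) ∧
      (BSDp W 3 ↔ MissingPPartOverCAt (W.baseChange K) 3) := by
  -- the twist `E^{(−3)}`, good ORDINARY at `3` (gen 7)
  haveI := W.isElliptic_quadraticTwist (pStar_ne_zero 3)
  obtain ⟨C₁, hCmin⟩ :=
    hasGlobalMinimalModel_rat_holds (W.quadraticTwist ((-1 : ℚ) ^ ((3 : ℕ) / 2) * (3 : ℕ)))
  haveI := hCmin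
  set W₁ := C₁ • W.quadraticTwist ((-1 : ℚ) ^ ((3 : ℕ) / 2) * (3 : ℕ)) with hW₁_def
  have hC₁ : C₁ • W.quadraticTwist ((-1 : ℚ) ^ ((3 : ℕ) / 2) * (3 : ℕ)) = W₁ := rfl
  have hord₁ : GoodOrd W₁ 3 := goodOrd_twist_three_of_typeGOrd W hX.typeGOrd hX.addv.2 W₁ ⟨C₁, hC₁⟩
  -- the Hoffstein–Luo supply and the field `ℚ(√(−3d'))`
  obtain ⟨d', Wd, iWd, iWdm, hsq, hd8, hpd, ⟨C, hC⟩, hord, hr0, -⟩ :=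
    exists_goodOrd_rankZero_nonAnom_twist_of_goodOrd_model W 3 hHL (by omega) W₁ ⟨C₁, hC₁⟩ hord₁
  obtain ⟨K, iF, iN, h2, hdK⟩ := exists_quadraticField_discr_pStar_mul 3 (by omega) hsq hd8 hpd
  have hdKQ : (NumberField.discr K : ℚ) = (-1 : ℚ) ^ ((3 : ℕ) / 2) * (3 : ℕ) * d' := by
    rw [hdK]; push_cast; ring
  have hpdK : ((3 : ℕ) : ℤ) ∣ NumberField.discr K := by
    rw [hdK]; exact ⟨(-1 : ℤ) ^ ((3 : ℕ) / 2) * d', by push_cast; ring⟩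
  have hd0 : ((-1 : ℚ) ^ ((3 : ℕ) / 2) * (3 : ℕ) * d') ≠ 0 :=
    mul_ne_zero (pStar_ne_zero 3) (by exact_mod_cast hsq.ne_zero)
  have hrd : Wd.analyticRank ≤ 1 := by rw [hr0]; exact zero_le_one
  have hrow : RowC16 Wd 3 :=
    ⟨rfl, hord, (irr_iff_of_model_twist hd0 ⟨C, hC⟩).mpr hX.classX4.2.2,
      Or.inl ((surj_iff_of_model_twist W 3 hd0 ⟨C, hC⟩).mpr hsurj)⟩
  have hbsd : BSDp Wd 3 := RowC16.bsdp hYZ hW20 hmod hGZK hrd hrow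
  have hWdK : ∃ C : VariableChange ℚ, C • W.quadraticTwist (NumberField.discr K : ℚ) = Wd := by
    rw [hdKQ]; exact ⟨C, hC⟩
  refine ⟨K, iF, iN, h2, by exact_mod_cast hpdK, fun w hw ↦ ?_,
    (missingPPartOverCAt_baseChange_iff_bsdp W 3 K Wd hGZK hmod hMilneC hr h2 hWdK hrd hbsd).symm⟩
  obtain ⟨hg, hu⟩ :=
    good_and_unitRoot_baseChange_of_goodOrd_model_twist_discr W 3 K h2 Wd hWdK hord w hw
  exact ⟨hg, hu, ramificationIdx_eq_two_of_dvd_discr 3 K w h2 hpdK hw⟩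

/-- **X3♯(G-ord) at `p = 3`, `r_an(E) ≤ 1 — the one-sentence form.** There is a quadratic field `K`
with `3 ∣ d_K` over which `E` has GOOD ORDINARY reduction at every prime `w ∋ 3` (`e(w|3) = 2`) and
for which `BSDp W 3 ↔ MissingPPartOverCAt (W.baseChange K) 3` (a non-anomalous rank-0 good ordinary
twist `E^{(−3d')}`, row C6). [cite: HoffsteinLuo1997, Theorem (§1, pp. 435–436)]
[cite: CastellaGrossiSkinner2025, Thm. D (= 'Thm. 4')] -/
theorem ClassX3Gord.exists_quadraticField_goodOrd_bsdp_iff_three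
    (hCGS : CastellaGrossiSkinner2025.thmD_padicValRat_bsd_rank_le_one)
    (hGV : GreenbergVatsal2000.thm13_charIdeal_eq_of_gvPar) (hGr : greenberg_charValue_rankZero)
    (hmod : hasEntireLFunction_rat) (hmodP : nonempty_modularParametrizationData)
    (hGZK : rank_eq_analyticRank_of_analyticRank_le_one)
    (hMilneC : Milne1972.bsdQuotient_baseChange_quadratic_anyModel)
    (hHL : HoffsteinLuo1997_exists_twist_L_one_ne_zero)
    (hX : ClassX3Gord W 3) (hr : W.analyticRank ≤ 1) :
    ∃ (K : Type) (_ : Field K) (_ : NumberField K), Module.finrank ℚ K = 2 ∧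
      (3 : ℤ) ∣ NumberField.discr K ∧
      (∀ w : HeightOneSpectrum (𝓞 K), ((3 : ℕ) : 𝓞 K) ∈ w.asIdeal →
        (W.baseChange K).HasGoodReductionAt w ∧ (W.baseChange K).HasUnitRootAt w ∧
          (Ideal.span {((3 : ℕ) : ℤ)}).ramificationIdx' w.asIdeal = 2) ∧
      (BSDp W 3 ↔ MissingPPartOverCAt (W.baseChange K) 3) := by
  haveI := W.isElliptic_quadraticTwist (pStar_ne_zero 3)
  obtain ⟨C₁, hCmin⟩ :=
    hasGlobalMinimalModel_rat_holds (W.quadraticTwist ((-1 : ℚ) ^ ((3 : ℕ) / 2) * (3 : ℕ)))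
  haveI := hCmin
  set W₁ := C₁ • W.quadraticTwist ((-1 : ℚ) ^ ((3 : ℕ) / 2) * (3 : ℕ)) with hW₁_def
  have hC₁ : C₁ • W.quadraticTwist ((-1 : ℚ) ^ ((3 : ℕ) / 2) * (3 : ℕ)) = W₁ := rfl
  have hord₁ : GoodOrd W₁ 3 := goodOrd_twist_three_of_typeGOrd W hX.typeGOrd hX.addv W₁ ⟨C₁, hC₁⟩
  obtain ⟨d', Wd, iWd, iWdm, hsq, hd8, hpd, ⟨C, hC⟩, hord, hr0, hna⟩ :=
    exists_goodOrd_rankZero_nonAnom_twist_of_goodOrd_model W 3 hHL (by omega) W₁ ⟨C₁, hC₁⟩ hord₁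
  obtain ⟨K, iF, iN, h2, hdK⟩ := exists_quadraticField_discr_pStar_mul 3 (by omega) hsq hd8 hpd
  have hdKQ : (NumberField.discr K : ℚ) = (-1 : ℚ) ^ ((3 : ℕ) / 2) * (3 : ℕ) * d' := by
    rw [hdK]; push_cast; ring
  have hpdK : ((3 : ℕ) : ℤ) ∣ NumberField.discr K := by
    rw [hdK]; exact ⟨(-1 : ℤ) ^ ((3 : ℕ) / 2) * d', by push_cast; ring⟩
  have hd0 : ((-1 : ℚ) ^ ((3 : ℕ) / 2) * (3 : ℕ) * d') ≠ 0 :=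
    mul_ne_zero (pStar_ne_zero 3) (by exact_mod_cast hsq.ne_zero)
  have hrd : Wd.analyticRank ≤ 1 := by rw [hr0]; exact zero_le_one
  have hbsd : BSDp Wd 3 := RowC6.bsdp hCGS hGV hGr hmod hmodP hGZK hrd
    (rowC6_twist_of_classX3_of_not_dvd W 3 Wd (by norm_num) hX.classX3 hd0 ⟨C, hC⟩ hord hna)
  have hWdK : ∃ C : VariableChange ℚ, C • W.quadraticTwist (NumberField.discr K : ℚ) = Wd := by
    rw [hdKQ]; exact ⟨C, hC⟩
  refine ⟨K, iF, iN, h2, by exact_mod_cast hpdK, fun w hw ↦ ?_,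
    (missingPPartOverCAt_baseChange_iff_bsdp W 3 K Wd hGZK hmod hMilneC hr h2 hWdK hrd hbsd).symm⟩
  obtain ⟨hg, hu⟩ :=
    good_and_unitRoot_baseChange_of_goodOrd_model_twist_discr W 3 K h2 Wd hWdK hord w hw
  exact ⟨hg, hu, ramificationIdx_eq_two_of_dvd_discr 3 K w h2 hpdK hw⟩

end Summit.BirchSwinnertonDyer.Rank1Residual.Additive

end
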